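import Literature.Computability.Complexity.GoldwasserSipserRefereeAgreement
import Literature.Computability.Complexity.GoldwasserSipserCompleteness
import Literature.Computability.Complexity.InteractiveProofsParallel
import Literature.Computability.Complexity.ArthurMerlinCollapseProofs
import HarnessLib

/-!
# The Goldwasser–Sipser theorem `IP[k] ⊆ AM[k+2]`, assembled (discharge of the named fact)

Fifth and last file of the PROOF of
`Literature.Computability.Complexity.GoldwasserSipser1986_IPk_subset_AMk` (`ArthurMerlinGames.lean`;
Arora–Barak Thm. 8.12, constant `k`; Goldwasser–Sipser, STOC 1986, §4.2 Main Theorem):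
**`GoldwasserSipser1986_IPk_subset_AMk_holds`**. Given `L ∈ IP[k]` with verifier `V`:

1. *error reduction* — the explicit parallel-repetition verifier
   `W = IPPar.parVerifier V (cntPoly q) (thrPoly q)` (`InteractiveProofsParallel.lean`) has error
   `≤ exp(-q(n))` (`parVerifier_acceptProb_ge` / `parVerifier_acceptProb_le`: the two halves of
   `IPRounds_subset_IPRoundsErr_exp`, restated for the explicit verifier because the polynomial `q`
   must be chosen AFTER `V` — the simulation loses a factor polynomial in the number of coins of the
   simulated verifier, which grows with `q`);
2. *the game* — Merlin's winning chance against the polynomial-time referee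
   `GSRef.gsRef W γ kFin R ∈ P` (`GoldwasserSipserRefereeBricks.lean`) is the value of the
   Goldwasser–Sipser game of `W` on the input (`GSRef.amValue_gsRef_eq`,
   `GoldwasserSipserRefereeAgreement.lean`), which is `≥ 1 - (R+1)/2^γ ≥ 3/4` on `x ∈ L`
   (`GoldwasserSipser.one_sub_le_gameValue`, since some prover of `W` is accepted with probability
   `≥ 1/2`) and `≤ 2 · 2^{γ + R(γ+β+1)} · exp(-q(n)) ≤ 1/3` on `x ∉ L` (`GoldwasserSipser.gameValue_le`),
   for the slack `γ = R + 2`, the bucket exponent `β = size (ℓ + 1) ≤ log₂ (2(ℓ+1))` and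
   `q = A₀ · (coins_V + 1)` with the constant `A₀ = 6 · 2^{γ+R(γ+1)} · 72^R · (2R+1)!`
   (`numerics_sound`: `exp q ≥ q^{2R+1}/(2R+1)!`);
3. *collapse* — so `L ∈ MA(2R+3) ⊆ AM(2) ⊆ AM(k+2)` (`R = ⌊k/2⌋`; Babai–Moran's Collapse Theorem,
   `MAk_succ_subset_AMk_two`, `AMk_two_subset_AMk` of `ArthurMerlinCollapseProofs.lean`).

Corollaries: `IPk_subset_AMk_two` (`IP[k] ⊆ AM[2]`) and the AB Remark 8.11(3) form. All proved,
no definitions, no new named facts.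

## References

* S. Arora, B. Barak, *Computational Complexity: A Modern Approach*, CUP 2009, Thm. 8.12 and
  §8.2.3 (sketch of proof), Remark 8.11.
* S. Goldwasser, M. Sipser, *Private coins versus public coins in interactive proof systems*,
  STOC 1986, 59–68, §4.2 (Main Theorem; Amplification Lemma).
* L. Babai, S. Moran, *Arthur–Merlin games: a randomized proof system, and a hierarchy of
  complexity classes*, JCSS 36 (1988), §1.5, Thm. 3.
-/

noncomputable section

namespace Literature.Computability.Complexity

open _root_.Computability Finset Polynomial Brick Plumb HashBricks Kannan AMPlayer GoldwasserSipser

open scoped Classical Nat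

/-! ### Error reduction for the explicit parallel-repetition verifier -/

namespace IPPar

/-- **Completeness of the parallel repetition (explicit verifier).** If `V` proves `L` in `k`
messages with error `1/3`, then on `x ∈ L` some prover is accepted by
`parVerifier V (cntPoly q) (thrPoly q)` with probability `≥ 1 - exp(-q(|x|))` (the parallel prover;
Hoeffding). The completeness half of `IPRounds_subset_IPRoundsErr_exp`, for the explicit verifier.
[cite: GoldwasserSipser1986, §4.2 (Amplification Lemma, p. 65)] [cite: Goldreich2001FoC1, Prop. 4.2.7] -/
theorem parVerifier_acceptProb_ge (V : IPVerifier) {k : ℕ → ℕ} {L : Language Bool} (hL : V.Proves k L)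
    (q : Polynomial ℕ) {x : List Bool} (hx : x ∈ L) :
    ∃ P : IPProver, 1 - Real.exp (-((q.eval x.length : ℕ) : ℝ)) ≤
      (parVerifier V (cntPoly q) (thrPoly q)).acceptProb (k x.length) x P := by
  set n := x.length with hn
  set t := (cntPoly q).eval n with ht
  set θ := (thrPoly q).eval n with hθ
  set c := V.coins.eval n with hc
  set m := V.msgLen.eval n with hm
  have htθ : t = 2 * θ := by rw [ht, hθ, cntPoly_eval]
  have ht0 : 0 < t := by rw [htθ, hθ, thrPoly_eval]; omega
  have ht1 : 2 * θ ≤ t + 1 := by omega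
  have hexp_le : Real.exp (-(t : ℝ) / 18) ≤ Real.exp (-((q.eval n : ℕ) : ℝ)) := by
    refine Real.exp_le_exp.2 ?_
    have : (t : ℝ) = 18 * (q.eval n + 1) := by rw [htθ, hθ, thrPoly_eval]; push_cast; ring
    rw [this]; linarith
  have h2c : (0 : ℝ) < 2 ^ c := by positivity
  have hpow : (2 : ℝ) ^ (t * c) = ((2 : ℝ) ^ c) ^ t := by rw [mul_comm, pow_mul]
  have hcardR : (Fintype.card (List.Vector Bool c) : ℝ) = 2 ^ c := by
    rw [card_vector, Fintype.card_bool]; push_cast; rfl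
  -- the two games and their identification
  set G := (V.game x m c).threshPar t θ with hG
  set G' := (parVerifier V (cntPoly q) (thrPoly q)).game x (t * m) (t * c) with hG'
  have hnext : ∀ r h, G'.next (tupleVecEquiv t c r) (h.map (tupleVecEquiv t m)) = tupleVecEquiv t m (G.next r h) :=
    game_par_next V (cntPoly q) (thrPoly q) x
  have hacc : ∀ r h, G'.accept (tupleVecEquiv t c r) (h.map (tupleVecEquiv t m)) ↔ G.accept r h :=
    game_par_accept V (cntPoly q) (thrPoly q) x
  obtain ⟨P, hPacc⟩ := (hL x).1 hx
  refine ⟨parProver P t m, ?_⟩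
  set σ := IPVerifier.stratOf m P with hσ
  have hcount : (1 - 1 / 3 : ℝ) * Fintype.card (List.Vector Bool c) ≤
      ((univ.filter fun r : List.Vector Bool c => (V.game x m c).accept r ((V.game x m c).transcript (k n) r σ)).card : ℝ) := by
    have h1 : (2 / 3 : ℝ) ≤ (cnt c {r | V.Accepts (k n) x r P} : ℝ) / 2 ^ c := by
      have := hPacc; unfold IPVerifier.acceptProb at this; rwa [uniformProb_eq_cnt_div] at this
    rw [le_div_iff₀ h2c, V.cnt_accepts_eq (k n) x P] at h1
    rw [hcardR]; linarith
  have hcomp := (V.game x m c).mul_bernoulliProb_le_card_accept_prodStrategy t θ (k n) (by norm_num : (1 / 3 : ℝ) ≤ 1) σ hcount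
  have htail := one_sub_bernoulliProb_atLeast_le_exp (t := t) (θ := θ) (by norm_num : (0 : ℝ) ≤ 1 / 3) le_rfl ht0 ht1
  -- the accepted joint coins of `parProver` are those of the product strategy
  have hcard : ((univ.filter fun v : List.Vector Bool (t * c) =>
      G'.accept v (G'.transcript (k n) v (IPVerifier.stratOf (t * m) (parProver P t m)))).card : ℝ) =
      ((univ.filter fun r : Fin t → List.Vector Bool c =>
        G.accept r (G.transcript (k n) r (PCGame.prodStrategy σ t))).card : ℝ) := by
    rw [stratOf_parProver]
    refine congrArg Nat.cast (card_equiv (tupleVecEquiv t c) fun r => ?_).symm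
    simp only [mem_filter, mem_univ, true_and, PCGame.transcript]
    have hp := PCGame.play_map_equiv G G' (tupleVecEquiv t c) (tupleVecEquiv t m) hnext r (PCGame.prodStrategy σ t) (k n) []
    rw [List.map_nil] at hp
    rw [hp, hacc]
  rw [acceptProb_eq_card_game _ x (k n) _ (parVerifier_coins V _ _ n) (parVerifier_msgLen V _ _ n), hcard, hpow,
    le_div_iff₀ (by positivity)]
  rw [hcardR] at hcomp
  have h3 : (1 - Real.exp (-((q.eval n : ℕ) : ℝ))) * ((2 : ℝ) ^ c) ^ t ≤
      ((2 : ℝ) ^ c) ^ t * bernoulliProb (AtLeast t θ) (fun _ => 1 - 1 / 3) := by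
    rw [mul_comm]
    exact mul_le_mul_of_nonneg_left (by linarith) (by positivity)
  exact h3.trans hcomp

/-- **Soundness of the parallel repetition (explicit verifier).** If `V` proves `L` in `k`
messages with error `1/3`, then on `x ∉ L` every prover is accepted by
`parVerifier V (cntPoly q) (thrPoly q)` with probability `≤ exp(-q(|x|))` (product bound against
correlated provers, `PCGame.opt_threshPar_nil_le_mul_bernoulliProb`; Hoeffding). The soundness half
of `IPRounds_subset_IPRoundsErr_exp`, for the explicit verifier.
[cite: GoldwasserSipser1986, §4.2 (Amplification Lemma, p. 65)] [cite: Goldreich2001FoC1, Prop. 4.2.7 and Ch. 4 Ex. 1] -/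
theorem parVerifier_acceptProb_le (V : IPVerifier) {k : ℕ → ℕ} {L : Language Bool} (hL : V.Proves k L)
    (q : Polynomial ℕ) {x : List Bool} (hx : x ∉ L) (Q : IPProver) :
    (parVerifier V (cntPoly q) (thrPoly q)).acceptProb (k x.length) x Q ≤
      Real.exp (-((q.eval x.length : ℕ) : ℝ)) := by
  set n := x.length with hn
  set t := (cntPoly q).eval n with ht
  set θ := (thrPoly q).eval n with hθ
  set c := V.coins.eval n with hc
  set m := V.msgLen.eval n with hm
  have htθ : t = 2 * θ := by rw [ht, hθ, cntPoly_eval]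
  have ht0 : 0 < t := by rw [htθ, hθ, thrPoly_eval]; omega
  have ht2 : (t : ℝ) ≤ 2 * θ := by rw [htθ]; push_cast; exact le_rfl
  have hexp_le : Real.exp (-(t : ℝ) / 18) ≤ Real.exp (-((q.eval n : ℕ) : ℝ)) := by
    refine Real.exp_le_exp.2 ?_
    have : (t : ℝ) = 18 * (q.eval n + 1) := by rw [htθ, hθ, thrPoly_eval]; push_cast; ring
    rw [this]; linarith
  have hpow : (2 : ℝ) ^ (t * c) = ((2 : ℝ) ^ c) ^ t := by rw [mul_comm, pow_mul]
  have hcardR : (Fintype.card (List.Vector Bool c) : ℝ) = 2 ^ c := by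
    rw [card_vector, Fintype.card_bool]; push_cast; rfl
  -- the two games and their identification
  set G := (V.game x m c).threshPar t θ with hG
  set G' := (parVerifier V (cntPoly q) (thrPoly q)).game x (t * m) (t * c) with hG'
  have hnext : ∀ r h, G'.next (tupleVecEquiv t c r) (h.map (tupleVecEquiv t m)) = tupleVecEquiv t m (G.next r h) :=
    game_par_next V (cntPoly q) (thrPoly q) x
  have hacc : ∀ r h, G'.accept (tupleVecEquiv t c r) (h.map (tupleVecEquiv t m)) ↔ G.accept r h :=
    game_par_accept V (cntPoly q) (thrPoly q) x
  have hs : ((V.game x m c).opt (k n) [] : ℝ) ≤ 1 / 3 * Fintype.card (List.Vector Bool c) := by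
    rw [hcardR]; exact V.optAccept_le_mul_two_pow ((hL x).2 hx)
  have hsound := (V.game x m c).opt_threshPar_nil_le_mul_bernoulliProb t θ (k n) (by norm_num : (0 : ℝ) ≤ 1 / 3)
    (by norm_num : (1 / 3 : ℝ) ≤ 1) hs
  have htail := bernoulliProb_atLeast_le_exp (t := t) (θ := θ) (by norm_num : (0 : ℝ) ≤ 1 / 3) le_rfl ht0 ht2
  have hopt : ((univ.filter fun v : List.Vector Bool (t * c) =>
      G'.accept v (G'.transcript (k n) v (IPVerifier.stratOf (t * m) Q))).card : ℝ) ≤ G.opt (k n) [] := by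
    have h1 := G'.card_accept_transcript_le_opt (IPVerifier.stratOf (t * m) Q) (k n)
    have h2 : G'.opt (k n) [] = G.opt (k n) [] := by
      have := PCGame.opt_map_equiv G G' (tupleVecEquiv t c) (tupleVecEquiv t m) hnext hacc (k n) []
      rwa [List.map_nil] at this
    exact_mod_cast h2 ▸ h1
  rw [acceptProb_eq_card_game _ x (k n) _ (parVerifier_coins V _ _ n) (parVerifier_msgLen V _ _ n), hpow,
    div_le_iff₀ (by positivity)]
  rw [hcardR] at hsound
  refine (hopt.trans hsound).trans ?_
  rw [mul_comm]
  exact mul_le_mul_of_nonneg_right (htail.trans hexp_le) (by positivity)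

end IPPar

/-! ### Numerics of the simulation -/

namespace GoldwasserSipser

/-- `2^{size t} ≤ 2 t` for `t ≥ 1` (the bucket exponent `β = size (ℓ + 1)` costs at most a factor
`2 (ℓ + 1)` per round). [folklore] -/
theorem two_pow_size_le {t : ℕ} (ht : 1 ≤ t) : 2 ^ t.size ≤ 2 * t := by
  have hs : 1 ≤ t.size := Nat.lt_size.2 (by simpa using ht)
  have h : 2 ^ (t.size - 1) ≤ t := Nat.lt_size.1 (by omega)
  calc 2 ^ t.size = 2 * 2 ^ (t.size - 1) := by rw [← pow_succ']; congr 1; omega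
    _ ≤ 2 * t := Nat.mul_le_mul_left 2 h

/-- `exp (-q) ≤ d! / q^d` for `q > 0` (from `q^d / d! ≤ exp q`). [folklore] -/
theorem exp_neg_le_factorial_div_pow {q : ℝ} (hq : 0 < q) (d : ℕ) :
    Real.exp (-q) ≤ (d ! : ℝ) / q ^ d := by
  have h := Real.pow_div_factorial_le_exp (x := q) (hx := hq.le) (n := d)
  have hqd : (0 : ℝ) < q ^ d := pow_pos hq d
  have hfac : (0 : ℝ) < d ! := by exact_mod_cast Nat.factorial_pos d
  rw [Real.exp_neg, inv_eq_one_div, div_le_div_iff₀ (Real.exp_pos q) hqd, one_mul]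
  rw [div_le_iff₀ hfac] at h
  linarith

/-- **The soundness numerics.** With `R` rounds, slack `γ`, the constant
`A₀ = 6 · 2^{γ + R(γ+1)} · 72^R · (2R+1)!`, any `q ≥ A₀ (c + 1)` with `q ≥ 1`, and a simulated
verifier with `ℓ` coins where `ℓ + 1 ≤ 36 q (c + 1)` and bucket exponent `β` with `2^β ≤ 2 (ℓ + 1)`:
the soundness bound `2 · 2^{γ + R(γ+β+1)} · exp(-q)` of the Goldwasser–Sipser game is `≤ 1/3`.
[cite: AroraBarakCC2009, Thm. 8.12 (§8.2.3)] -/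
theorem numerics_sound (R γ c q ℓ β : ℕ) (hq : 6 * 2 ^ (γ + R * (γ + 1)) * 72 ^ R * (2 * R + 1)! * (c + 1) ≤ q)
    (hℓ : ℓ + 1 ≤ 36 * q * (c + 1)) (hβ : 2 ^ β ≤ 2 * (ℓ + 1)) :
    2 * (2 : ℝ) ^ (γ + R * (γ + β + 1)) * Real.exp (-(q : ℝ)) ≤ 1 / 3 := by
  set A₀ := 6 * 2 ^ (γ + R * (γ + 1)) * 72 ^ R * (2 * R + 1)! with hA₀
  clear_value A₀
  have hA₀1 : 1 ≤ A₀ := by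
    rw [hA₀]
    exact Nat.mul_pos (Nat.mul_pos (Nat.mul_pos (by norm_num) (Nat.two_pow_pos _)) (Nat.pow_pos (by norm_num)))
      (Nat.factorial_pos _)
  have hq1 : 1 ≤ q := le_trans (Nat.mul_pos hA₀1 (Nat.succ_pos c)) hq
  -- the key inequality in `ℕ`: `6 · 2^{γ+R(γ+1)} · (2^β)^R · (2R+1)! ≤ q^{2R+1}`
  have hβR : (2 ^ β) ^ R ≤ 72 ^ R * q ^ R * (c + 1) ^ R := by
    rw [← mul_pow, ← mul_pow]
    exact Nat.pow_le_pow_left (hβ.trans (by nlinarith)) R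
  have hkey : 6 * 2 ^ (γ + R * (γ + 1)) * (2 ^ β) ^ R * (2 * R + 1)! ≤ q ^ (2 * R + 1) := by
    have h1 : 6 * 2 ^ (γ + R * (γ + 1)) * (2 ^ β) ^ R * (2 * R + 1)! ≤ A₀ * (c + 1) ^ R * q ^ R := by
      calc 6 * 2 ^ (γ + R * (γ + 1)) * (2 ^ β) ^ R * (2 * R + 1)!
          ≤ 6 * 2 ^ (γ + R * (γ + 1)) * (72 ^ R * q ^ R * (c + 1) ^ R) * (2 * R + 1)! :=
            Nat.mul_le_mul_right _ (Nat.mul_le_mul_left _ hβR)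
        _ = A₀ * (c + 1) ^ R * q ^ R := by rw [hA₀]; ring
    have h2 : A₀ * (c + 1) ^ R ≤ q ^ (R + 1) := by
      have h5 : 1 ≤ A₀ ^ R * (c + 1) := Nat.mul_pos (Nat.pow_pos hA₀1) (Nat.succ_pos c)
      calc A₀ * (c + 1) ^ R = A₀ * (c + 1) ^ R * 1 := (mul_one _).symm
        _ ≤ A₀ * (c + 1) ^ R * (A₀ ^ R * (c + 1)) := Nat.mul_le_mul_left _ h5
        _ = (A₀ * (c + 1)) * (A₀ * (c + 1)) ^ R := by rw [mul_pow A₀ (c + 1) R]; ring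
        _ ≤ q * q ^ R := Nat.mul_le_mul hq (Nat.pow_le_pow_left hq R)
        _ = q ^ (R + 1) := by ring
    calc 6 * 2 ^ (γ + R * (γ + 1)) * (2 ^ β) ^ R * (2 * R + 1)! ≤ A₀ * (c + 1) ^ R * q ^ R := h1
      _ ≤ q ^ (R + 1) * q ^ R := Nat.mul_le_mul_right _ h2
      _ = q ^ (2 * R + 1) := by rw [← pow_add]; congr 1; ring
  -- in `ℝ`
  have hqpos : (0 : ℝ) < q := by exact_mod_cast hq1
  have hexp := exp_neg_le_factorial_div_pow hqpos (2 * R + 1)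
  have hqd : (0 : ℝ) < (q : ℝ) ^ (2 * R + 1) := pow_pos hqpos _
  have hkeyR : (6 : ℝ) * 2 ^ (γ + R * (γ + 1)) * (2 ^ β) ^ R * (2 * R + 1)! ≤ (q : ℝ) ^ (2 * R + 1) := by
    exact_mod_cast hkey
  have hsplit : (2 : ℝ) ^ (γ + R * (γ + β + 1)) = 2 ^ (γ + R * (γ + 1)) * (2 ^ β) ^ R := by
    rw [← pow_mul, ← pow_add]; congr 1; ring
  rw [hsplit]
  have hD : (0 : ℝ) ≤ 2 ^ (γ + R * (γ + 1)) * (2 ^ β) ^ R := by positivity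
  calc 2 * (2 ^ (γ + R * (γ + 1)) * ((2 : ℝ) ^ β) ^ R) * Real.exp (-(q : ℝ))
      ≤ 2 * (2 ^ (γ + R * (γ + 1)) * ((2 : ℝ) ^ β) ^ R) * ((2 * R + 1)! / (q : ℝ) ^ (2 * R + 1)) :=
        mul_le_mul_of_nonneg_left hexp (by positivity)
    _ = (6 * 2 ^ (γ + R * (γ + 1)) * ((2 : ℝ) ^ β) ^ R * (2 * R + 1)!) / (q : ℝ) ^ (2 * R + 1) / 3 := by ring
    _ ≤ (q : ℝ) ^ (2 * R + 1) / (q : ℝ) ^ (2 * R + 1) / 3 := by gcongr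
    _ = 1 / 3 := by rw [div_self hqd.ne']

/-- **The completeness numerics**: with slack `γ = R + 2`, `1 - (R + 1)/2^γ ≥ 3/4`. [folklore] -/
theorem numerics_complete (R : ℕ) : (3 / 4 : ℝ) ≤ 1 - ((R : ℝ) + 1) / 2 ^ (R + 2) := by
  have hR : (R : ℝ) + 1 ≤ 2 ^ R := by
    exact_mod_cast (Nat.succ_le_of_lt Nat.lt_two_pow_self : R + 1 ≤ 2 ^ R)
  have h4 : (2 : ℝ) ^ (R + 2) = 4 * 2 ^ R := by rw [pow_add]; ring
  have key : ((R : ℝ) + 1) / 2 ^ (R + 2) ≤ 1 / 4 := by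
    rw [h4, div_le_div_iff₀ (by positivity) (by norm_num)]
    nlinarith [hR, pow_pos (zero_lt_two' ℝ) R]
  linarith

/-- `exp (-q) ≤ 1/2` for `q ≥ 1`. [folklore] -/
theorem exp_neg_le_half {q : ℝ} (hq : 1 ≤ q) : Real.exp (-q) ≤ 1 / 2 := by
  have h1 : Real.exp (-q) ≤ Real.exp (-1) := Real.exp_le_exp.2 (by linarith)
  have h2 : (2 : ℝ) ≤ Real.exp 1 := by have := Real.add_one_le_exp (1 : ℝ); linarith
  have h3 : Real.exp (-1) ≤ 1 / 2 := by
    rw [Real.exp_neg, inv_eq_one_div, div_le_div_iff₀ (Real.exp_pos 1) two_pos]; linarith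
  exact h1.trans h3

end GoldwasserSipser

/-! ### The theorem -/

/-- **The move-length polynomial** of the simulating game is adequate: with `M = (ℓ + m + 2)²`,
two messages and a bucket block, hashes of messages and hashes of coin strings all fit in a move.
[cite: AroraBarakCC2009, §8.2.3] -/
theorem GoldwasserSipser.adequate_sq (ℓ m k β γ : ℕ) :
    (Params.mk ℓ m k β γ ((ℓ + m + 2) ^ 2)).Adequate where
  msgs_le := by
    show 2 * m + ℓ + 1 ≤ (ℓ + m + 2) ^ 2
    rw [sq]
    exact le_trans (by omega : 2 * m + ℓ + 1 ≤ 2 * (ℓ + m + 2)) (Nat.mul_le_mul_right _ (by omega))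
  hashMsg_le := by
    show (ℓ + 1) * (m + 1) ≤ (ℓ + m + 2) ^ 2
    rw [sq]
    exact Nat.mul_le_mul (by omega) (by omega)
  hashCoins_le := by
    show (ℓ + 1) * (ℓ + 1) ≤ (ℓ + m + 2) ^ 2
    rw [sq]
    exact Nat.mul_le_mul (by omega) (by omega)

/-- **Goldwasser–Sipser 1986 / Arora–Barak Thm. 8.12 (constant `k`): `IP[k] ⊆ AM[k+2]`**, PROVED —
the discharge of the named fact `GoldwasserSipser1986_IPk_subset_AMk`. Error reduction of the
private-coin verifier to `exp(-q(n))` by parallel repetition; public-coin simulation by the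
round-by-round set-lower-bound game with a polynomial-time referee (`MA(2R+3)`, `R = ⌊k/2⌋`);
Babai–Moran's Collapse Theorem (`MA(2R+3) = AM(2) = AM(k+2)`).
[cite: GoldwasserSipser1986, §4.2 Main Theorem] [cite: AroraBarakCC2009, Thm. 8.12]
[cite: BabaiMoran1988, Thm. 3] -/
theorem GoldwasserSipser1986_IPk_subset_AMk_holds : GoldwasserSipser1986_IPk_subset_AMk := by
  intro k L hL
  obtain ⟨V, hV, hVL⟩ := hL
  -- parameters
  set R := k / 2 with hR
  set γ := R + 2 with hγ
  set A₀ := 6 * 2 ^ (γ + R * (γ + 1)) * 72 ^ R * (2 * R + 1)! with hA₀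
  set q : Polynomial ℕ := Polynomial.C A₀ * (V.coins + 1) with hq
  have hq_eval : ∀ n, q.eval n = A₀ * (V.coins.eval n + 1) := fun n => by simp [hq]
  set W := IPPar.parVerifier V (cntPoly q) (thrPoly q) with hW
  have hWpoly : W.IsPolyTime := IPPar.parVerifier_isPolyTime (cntPoly q) (thrPoly q) hV
  have hWcoins : ∀ n, W.coins.eval n = (18 * q.eval n + 18) * V.coins.eval n := fun n => by
    rw [hW, IPPar.parVerifier_coins, cntPoly_eval, thrPoly_eval]; ring
  set Mv : Polynomial ℕ := (W.coins + W.msgLen + 2) ^ 2 with hMv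
  have hMv_eval : ∀ n, Mv.eval n = (W.coins.eval n + W.msgLen.eval n + 2) ^ 2 := fun n => by simp [hMv]
  -- the parameter record on inputs of length `n`
  set pp : ℕ → Params := fun n => Params.mk (W.coins.eval n) (W.msgLen.eval n) k
    (Nat.size (W.coins.eval n + 1)) γ (Mv.eval n) with hpp
  have hppR : ∀ n, (pp n).R = R := fun n => rfl
  have hppAd : ∀ n, (pp n).Adequate := fun n => by
    have h := GoldwasserSipser.adequate_sq (W.coins.eval n) (W.msgLen.eval n) k (Nat.size (W.coins.eval n + 1)) γ
    rw [← hMv_eval n] at h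
    exact h
  have hppβ : ∀ n, (pp n).ℓ + 1 ≤ 2 ^ (pp n).β := fun n => (Nat.lt_size_self _).le
  -- membership in `MA(2R+3)`
  have hMA : L ∈ MAk (2 * R + 3) := by
    rw [MAk_eq, mem_AMGames_iff]
    refine ⟨GSRef.gsRef W γ (pp 0).kFin R, GSRef.gsRef_mem_P W γ (pp 0).kFin R hWpoly, Mv, fun x => ?_⟩
    set n := x.length with hn
    have hkf : (pp 0).kFin = (pp n).kFin := rfl
    have hval : amValue (GSRef.gsRef W γ (pp 0).kFin R) (Mv.eval n) (merlin.alternate (2 * R + 3)) x =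
        gameValue (payoff (pp n) (W.game x (pp n).m (pp n).ℓ)) (pp n).M (merlin.alternate (2 * (pp n).R + 3)) [] :=
      GSRef.amValue_gsRef_eq W x (pp n) rfl rfl rfl (hppAd n).two_m_le (hppAd n).ℓ_le
    rw [hval]
    -- the optimal accepting-coin count of `W` on `x`
    have hopt : (W.game x (pp n).m (pp n).ℓ).opt (pp n).k [] = W.optAccept k x := rfl
    have hq1 : 1 ≤ q.eval n := by
      rw [hq_eval]
      have hA₀1 : 1 ≤ A₀ :=
        Nat.mul_pos (Nat.mul_pos (Nat.mul_pos (by norm_num) (Nat.two_pow_pos _)) (Nat.pow_pos (by norm_num)))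
          (Nat.factorial_pos _)
      exact Nat.mul_pos hA₀1 (Nat.succ_pos _)
    have he_half : Real.exp (-((q.eval n : ℕ) : ℝ)) ≤ 1 / 2 :=
      GoldwasserSipser.exp_neg_le_half (by exact_mod_cast hq1)
    constructor
    · -- completeness: some prover of `W` is accepted with probability `≥ 1 - exp(-q) ≥ 1/2`
      intro hx
      obtain ⟨P, hP⟩ := IPPar.parVerifier_acceptProb_ge V hVL q hx
      have h12 : (1 / 2 : ℝ) ≤ W.acceptProb k x P := by
        have := hP; rw [← hW] at this; linarith
      have hN : (1 / 2 : ℝ) * 2 ^ W.coins.eval n ≤ W.optAccept k x := W.mul_two_pow_le_optAccept h12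
      have hN' : 2 ^ W.coins.eval n ≤ 2 * W.optAccept k x := by
        have : ((2 ^ W.coins.eval n : ℕ) : ℝ) ≤ ((2 * W.optAccept k x : ℕ) : ℝ) := by push_cast; linarith
        exact_mod_cast this
      have hN2 : 2 ^ ((pp n).ℓ - 1) ≤ (W.game x (pp n).m (pp n).ℓ).opt (pp n).k [] := by
        rw [hopt]; exact GoldwasserSipser.two_pow_sub_le_of_le_mul hN'
      have hcomp := GoldwasserSipser.one_sub_le_gameValue (pp n) (W.game x (pp n).m (pp n).ℓ) (hppAd n) (hppβ n) hN2
      have hnum := GoldwasserSipser.numerics_complete R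
      have h34 : (2 / 3 : ℝ) ≤ 1 - ((pp n).R + 1) / 2 ^ (pp n).γ := by
        rw [hppR]; show (2 / 3 : ℝ) ≤ 1 - ((R : ℝ) + 1) / 2 ^ (R + 2); linarith
      exact h34.trans hcomp
    · -- soundness: every prover of `W` is accepted with probability `≤ exp(-q)`
      intro hx
      have hs : ∀ Q : IPProver, W.acceptProb k x Q ≤ Real.exp (-((q.eval n : ℕ) : ℝ)) := fun Q =>
        IPPar.parVerifier_acceptProb_le V hVL q hx Q
      have hN : (W.optAccept k x : ℝ) ≤ Real.exp (-((q.eval n : ℕ) : ℝ)) * 2 ^ W.coins.eval n :=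
        W.optAccept_le_mul_two_pow hs
      have hsound := GoldwasserSipser.gameValue_le (pp n) (W.game x (pp n).m (pp n).ℓ) (hppAd n)
      refine hsound.trans ?_
      rw [hopt, hppR]
      have hD := GoldwasserSipser.D_pos (pp n) R
      have h2ℓ : (0 : ℝ) < 2 ^ W.coins.eval n := by positivity
      -- `2 · D R · opt / 2^ℓ ≤ 2 · D R · exp(-q) ≤ 1/3`
      have hnum : 2 * GoldwasserSipser.D (pp n) R * Real.exp (-((q.eval n : ℕ) : ℝ)) ≤ 1 / 3 := by
        have h := GoldwasserSipser.numerics_sound R γ (V.coins.eval n) (q.eval n) (W.coins.eval n)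
          (Nat.size (W.coins.eval n + 1)) (by rw [hq_eval]) (by rw [hWcoins]; nlinarith)
          (GoldwasserSipser.two_pow_size_le (Nat.succ_le_succ (Nat.zero_le _)))
        exact h
      calc 2 * GoldwasserSipser.D (pp n) R * ((W.optAccept k x : ℕ) : ℝ) / 2 ^ (pp n).ℓ
          ≤ 2 * GoldwasserSipser.D (pp n) R * (Real.exp (-((q.eval n : ℕ) : ℝ)) * 2 ^ W.coins.eval n) /
              2 ^ (pp n).ℓ :=
            div_le_div_of_nonneg_right (mul_le_mul_of_nonneg_left hN (by positivity)) (by positivity)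
        _ = 2 * GoldwasserSipser.D (pp n) R * Real.exp (-((q.eval n : ℕ) : ℝ)) := by
            show _ / (2 : ℝ) ^ W.coins.eval n = _
            field_simp
        _ ≤ 1 / 3 := hnum
  -- collapse: `MA(2R+3) ⊆ AM(2) ⊆ AM(k+2)`
  have h1 : L ∈ AMk 2 := MAk_succ_subset_AMk_two (k := 2 * R + 2) (by omega) hMA
  exact AMk_two_subset_AMk (by omega) h1

/-- **`IP[k] ⊆ AM[2]` for every constant `k`** (Goldwasser–Sipser with Babai–Moran's collapse).
[cite: BabaiMoran1988, §1.5 and Thm. 3] [cite: AroraBarakCC2009, Thm. 8.12 and Remark 8.11] -/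
theorem IPk_subset_AMk_two (k : ℕ) : IPk k ⊆ AMk 2 := fun L hL =>
  AMk_subset_AMk_two (k + 2) (by omega) (GoldwasserSipser1986_IPk_subset_AMk_holds k hL)

end Literature.Computability.Complexity

end
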